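import Mathlib
import HarnessLib

/-!
# `DensityLadder.SeparatedTowerDensityLine` (item stmt-RiemannHypothesis-24918) — the Gaussian
# unit-window (Schur) estimate for log-bounded window masses (core of step (f) of stub S1)

LINE L57 «sieve sight above the density line» (rh-idea-10 g1), crux K1 `SeparatedTowerDensityLine`,
stub S1 of the registered skeleton `Birth.lean`, step (f) of the mean-value argument (seat memo
`MEANVALUE-SECOND-READ.md` on stmt-RiemannHypothesis-24918).  For the tame zeros (unit-window mass
`≤ C log(|t|+2)`) the mean square against the Gaussian needs, for each fixed ordinate `y`,
`Σ_j m_j e^{−c(γ_j − y)²} ≪_c log(|y|+2)`.  With the unit-window summation of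
`DensityLadderSeparatedTowerWindows` this reduces to the window estimate proved here:
`e^{−c(s−y)²} ≤ e^{c} e^{−c(⌊s⌋−⌊y⌋)²/2}` and, for every finite `S ⊆ ℤ`,
`Σ_{n∈S} log(|n|+2) e^{c − c(n−⌊y⌋)²/2} ≤ K(c) log(|y|+2)` with `K(c)` independent of `y` and `S`.
Cell rh-split, seat rh-split-prover-l57 g0.  RH-free, ζ-free; FRONTIER bookkeeping; nothing here
bears on the truth of RH.
-/

set_option linter.dupNamespace false

noncomputable section

open Filter Set Topology

namespace Summit.RiemannHypothesis.RiemannHypothesis.Theorems.DensityLadderSeparatedTowerSchur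

/-- **Gaussian window bound**: `e^{−c(s−y)²} ≤ e^{c − c(⌊s⌋−⌊y⌋)²/2}` (`c ≥ 0`), since
`|s − y| ≥ |⌊s⌋ − ⌊y⌋| − 1` and `(x−1)² ≥ x²/2 − 1`. [folklore] -/
theorem exp_neg_sq_le_window {c : ℝ} (hc : 0 ≤ c) (s y : ℝ) :
    Real.exp (-(c * (s - y) ^ 2)) ≤
      Real.exp (c - c * (((⌊s⌋ - ⌊y⌋ : ℤ) : ℝ)) ^ 2 / 2) := by
  rw [Real.exp_le_exp]
  set k : ℝ := ((⌊s⌋ - ⌊y⌋ : ℤ) : ℝ) with hk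
  have h1 : |(s - y) - k| ≤ 1 := by
    have hs1 := Int.floor_le s; have hs2 := Int.lt_floor_add_one s
    have hy1 := Int.floor_le y; have hy2 := Int.lt_floor_add_one y
    rw [hk]; push_cast
    rw [abs_le]; constructor <;> linarith
  -- `(s-y)² ≥ k²/2 - 1`
  have h2 : k ^ 2 / 2 - 1 ≤ (s - y) ^ 2 := by
    have := abs_le.1 h1
    nlinarith [sq_nonneg ((s - y) - k + (s - y)), sq_nonneg (s - y - k), sq_nonneg (2 * (s - y) - k)]
  nlinarith [mul_le_mul_of_nonneg_left h2 hc]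

/-- **Splitting the logarithmic window mass**: `log(|n|+2) ≤ log(|y|+2) + log(|n − ⌊y⌋|+3)`.
[folklore] -/
theorem log_window_split (n : ℤ) (y : ℝ) :
    Real.log (|(n : ℝ)| + 2) ≤ Real.log (|y| + 2) + Real.log (|((n - ⌊y⌋ : ℤ) : ℝ)| + 3) := by
  rw [← Real.log_mul (by positivity) (by positivity)]
  refine Real.log_le_log (by positivity) ?_
  have hy1 := Int.floor_le y; have hy2 := Int.lt_floor_add_one y
  have h1 : |(n : ℝ)| ≤ |y| + |((n - ⌊y⌋ : ℤ) : ℝ)| + 1 := by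
    push_cast
    have := abs_add_le (y : ℝ) ((n : ℝ) - ⌊y⌋)
    have e : (n : ℝ) = y + ((n : ℝ) - ⌊y⌋) + (⌊y⌋ - y) := by ring
    calc |(n : ℝ)| = |y + ((n : ℝ) - ⌊y⌋) + (⌊y⌋ - y)| := by rw [← e]
      _ ≤ |y + ((n : ℝ) - ⌊y⌋)| + |(⌊y⌋ : ℝ) - y| := abs_add_le _ _
      _ ≤ |y| + |(n : ℝ) - ⌊y⌋| + 1 := by
          have : |(⌊y⌋ : ℝ) - y| ≤ 1 := abs_le.2 ⟨by linarith, by linarith⟩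
          linarith
  nlinarith [abs_nonneg y, abs_nonneg (((n - ⌊y⌋ : ℤ) : ℝ))]

/-- A finite sum over `ℤ` of an even non-negative summable profile is at most twice the sum over `ℕ`.
[folklore] -/
theorem sum_int_le_two_tsum_nat (G : ℕ → ℝ) (hG0 : ∀ j, 0 ≤ G j) (hGs : Summable G)
    (S : Finset ℤ) : ∑ k ∈ S, G k.natAbs ≤ 2 * ∑' j, G j := by
  classical
  rw [← Finset.sum_fiberwise_of_maps_to (g := Int.natAbs) (t := S.image Int.natAbs)
    (fun k hk ↦ Finset.mem_image_of_mem _ hk)]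
  have hfib : ∀ j ∈ S.image Int.natAbs,
      ∑ k ∈ S.filter (fun k ↦ k.natAbs = j), G k.natAbs ≤ 2 * G j := by
    intro j _
    have hsub : S.filter (fun k ↦ k.natAbs = j) ⊆ {(j : ℤ), -(j : ℤ)} := by
      intro k hk
      rw [Finset.mem_filter] at hk
      rw [Finset.mem_insert, Finset.mem_singleton]
      exact Int.natAbs_eq_iff.1 hk.2
    calc ∑ k ∈ S.filter (fun k ↦ k.natAbs = j), G k.natAbs
        = ∑ k ∈ S.filter (fun k ↦ k.natAbs = j), G j :=
          Finset.sum_congr rfl fun k hk ↦ by rw [(Finset.mem_filter.1 hk).2]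
      _ = (S.filter (fun k ↦ k.natAbs = j)).card * G j := by rw [Finset.sum_const, nsmul_eq_mul]
      _ ≤ 2 * G j := by
          refine mul_le_mul_of_nonneg_right ?_ (hG0 j)
          exact_mod_cast (Finset.card_le_card hsub).trans Finset.card_le_two
  calc ∑ j ∈ S.image Int.natAbs, ∑ k ∈ S.filter (fun k ↦ k.natAbs = j), G k.natAbs
      ≤ ∑ j ∈ S.image Int.natAbs, 2 * G j := Finset.sum_le_sum hfib
    _ = 2 * ∑ j ∈ S.image Int.natAbs, G j := by rw [Finset.mul_sum]
    _ ≤ 2 * ∑' j, G j := by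
        refine mul_le_mul_of_nonneg_left ?_ (by norm_num)
        exact hGs.sum_le_tsum _ fun j _ ↦ hG0 j

/-- The profile `(A + log(j+3)) e^{−c j²/2}` is summable over `ℕ` (`c > 0`, dominated by
`(A + 3 + j) r^j`, `r = e^{−c/2}`). [folklore] -/
theorem summable_log_gauss {c : ℝ} (hc : 0 < c) {A : ℝ} (hA : 0 ≤ A) :
    Summable fun j : ℕ ↦ (A + Real.log ((j : ℝ) + 3)) * Real.exp (-(c * (j : ℝ) ^ 2 / 2)) := by
  set r : ℝ := Real.exp (-(c / 2)) with hr
  have hr0 : 0 ≤ r := (Real.exp_pos _).le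
  have hr1 : ‖r‖ < 1 := by
    rw [Real.norm_of_nonneg hr0, hr]; exact Real.exp_lt_one_iff.2 (by linarith)
  have h1 : Summable fun j : ℕ ↦ ((j : ℝ) ^ 1) * r ^ j := summable_pow_mul_geometric_of_norm_lt_one 1 hr1
  have h0 : Summable fun j : ℕ ↦ r ^ j := summable_geometric_of_lt_one hr0 (by simpa [Real.norm_of_nonneg hr0] using hr1)
  have hmaj : Summable fun j : ℕ ↦ (A + 3) * r ^ j + (j : ℝ) ^ 1 * r ^ j := (h0.mul_left _).add h1
  have hlog0 : ∀ j : ℕ, 0 ≤ Real.log ((j : ℝ) + 3) := fun j ↦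
    Real.log_nonneg (by linarith [(Nat.cast_nonneg j : (0:ℝ) ≤ j)])
  refine Summable.of_nonneg_of_le (fun j ↦ mul_nonneg (add_nonneg hA (hlog0 j)) (Real.exp_pos _).le)
    (fun j ↦ ?_) hmaj
  have hlog : Real.log ((j : ℝ) + 3) ≤ (j : ℝ) + 3 := by
    have := Real.log_le_sub_one_of_pos (show (0 : ℝ) < (j : ℝ) + 3 by positivity); linarith
  have hexp : Real.exp (-(c * (j : ℝ) ^ 2 / 2)) ≤ r ^ j := by
    rw [hr, ← Real.exp_nat_mul, Real.exp_le_exp]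
    have hj : (0 : ℝ) ≤ j := Nat.cast_nonneg j
    have : (j : ℝ) ≤ (j : ℝ) ^ 2 := by
      rcases Nat.eq_zero_or_pos j with h | h
      · subst h; simp
      · have h1 : (1 : ℝ) ≤ j := by exact_mod_cast h
        nlinarith
    nlinarith
  have hlog0 : 0 ≤ Real.log ((j : ℝ) + 3) := hlog0 j
  calc (A + Real.log ((j : ℝ) + 3)) * Real.exp (-(c * (j : ℝ) ^ 2 / 2))
      ≤ (A + ((j : ℝ) + 3)) * r ^ j := mul_le_mul (by linarith) hexp (Real.exp_pos _).le (by positivity)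
    _ = (A + 3) * r ^ j + (j : ℝ) ^ 1 * r ^ j := by ring

/-- **The Gaussian unit-window (Schur) estimate for logarithmic masses.** For `c > 0` there is
`K > 0` such that for every real `y` and every finite `S ⊆ ℤ`,
`Σ_{n∈S} log(|n|+2) · e^{c − c(n−⌊y⌋)²/2} ≤ K log(|y|+2)`. [folklore] -/
theorem exists_window_gauss_log_le {c : ℝ} (hc : 0 < c) :
    ∃ K : ℝ, 0 < K ∧ ∀ (y : ℝ) (S : Finset ℤ),
      ∑ n ∈ S, Real.log (|(n : ℝ)| + 2) * Real.exp (c - c * (((n - ⌊y⌋ : ℤ) : ℝ)) ^ 2 / 2) ≤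
        K * Real.log (|y| + 2) := by
  classical
  -- the two constants
  set G₁ : ℕ → ℝ := fun j ↦ (0 + Real.log ((j : ℝ) + 3)) * Real.exp (-(c * (j : ℝ) ^ 2 / 2)) with hG₁
  set G₀ : ℕ → ℝ := fun j ↦ Real.exp (-(c * (j : ℝ) ^ 2 / 2)) with hG₀
  have hG₁s : Summable G₁ := summable_log_gauss hc le_rfl
  have hG₀s : Summable G₀ := by
    have h := summable_log_gauss hc (A := 1) zero_le_one
    refine Summable.of_nonneg_of_le (fun j ↦ (Real.exp_pos _).le) (fun j ↦ ?_) h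
    have hlog0 : 0 ≤ Real.log ((j : ℝ) + 3) := Real.log_nonneg (by linarith [(Nat.cast_nonneg j : (0:ℝ) ≤ j)])
    rw [hG₀]; simp only
    nlinarith [Real.exp_pos (-(c * (j : ℝ) ^ 2 / 2))]
  have hG₁0 : ∀ j, 0 ≤ G₁ j := fun j ↦ by
    rw [hG₁]; simp only [zero_add]
    exact mul_nonneg (Real.log_nonneg (by linarith [(Nat.cast_nonneg j : (0:ℝ) ≤ j)])) (Real.exp_pos _).le
  have hG₀0 : ∀ j, 0 ≤ G₀ j := fun j ↦ (Real.exp_pos _).le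
  set T₀ : ℝ := ∑' j, G₀ j with hT₀
  set T₁ : ℝ := ∑' j, G₁ j with hT₁
  have hT₀0 : 0 ≤ T₀ := tsum_nonneg hG₀0
  have hT₁0 : 0 ≤ T₁ := tsum_nonneg hG₁0
  have hlog2 : 0 < Real.log 2 := Real.log_pos (by norm_num)
  refine ⟨Real.exp c * 2 * (T₀ + T₁ / Real.log 2) + 1, by positivity, fun y S ↦ ?_⟩
  have hLy : Real.log 2 ≤ Real.log (|y| + 2) := Real.log_le_log (by norm_num) (by linarith [abs_nonneg y])
  have hLy0 : 0 ≤ Real.log (|y| + 2) := hlog2.le.trans hLy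
  -- reindex `k = n - ⌊y⌋`
  set S' : Finset ℤ := S.map (Equiv.subRight ⌊y⌋).toEmbedding with hS'
  have hreindex : ∑ n ∈ S, Real.log (|(n : ℝ)| + 2) * Real.exp (c - c * (((n - ⌊y⌋ : ℤ) : ℝ)) ^ 2 / 2) =
      ∑ k ∈ S', Real.log (|((k + ⌊y⌋ : ℤ) : ℝ)| + 2) * Real.exp (c - c * ((k : ℤ) : ℝ) ^ 2 / 2) := by
    rw [hS', Finset.sum_map]
    refine Finset.sum_congr rfl fun n _ ↦ ?_
    simp [Equiv.subRight]
  rw [hreindex]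
  -- termwise bound by the even profile
  have hterm : ∀ k ∈ S', Real.log (|((k + ⌊y⌋ : ℤ) : ℝ)| + 2) * Real.exp (c - c * ((k : ℤ) : ℝ) ^ 2 / 2) ≤
      Real.exp c * (Real.log (|y| + 2) * G₀ k.natAbs + G₁ k.natAbs) := by
    intro k _
    have hsplit := log_window_split (k + ⌊y⌋) y
    rw [show (k + ⌊y⌋ - ⌊y⌋ : ℤ) = k by ring] at hsplit
    have hkabs : ((k.natAbs : ℕ) : ℝ) = |((k : ℤ) : ℝ)| := by
      rw [Nat.cast_natAbs, Int.cast_abs]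
    have hexp : Real.exp (c - c * ((k : ℤ) : ℝ) ^ 2 / 2) = Real.exp c * Real.exp (-(c * ((k.natAbs : ℕ) : ℝ) ^ 2 / 2)) := by
      rw [← Real.exp_add, hkabs, sq_abs]; ring_nf
    rw [hexp, hG₀, hG₁]
    simp only [zero_add]
    rw [hkabs]
    have hE : 0 ≤ Real.exp (-(c * |((k : ℤ) : ℝ)| ^ 2 / 2)) := (Real.exp_pos _).le
    have hlogn0 : 0 ≤ Real.log (|(((k + ⌊y⌋ : ℤ)) : ℝ)| + 2) := Real.log_nonneg (by linarith [abs_nonneg ((((k + ⌊y⌋ : ℤ)) : ℝ))])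
    nlinarith [mul_le_mul_of_nonneg_right hsplit (mul_nonneg (Real.exp_pos c).le hE)]
  refine (Finset.sum_le_sum hterm).trans ?_
  rw [← Finset.mul_sum, Finset.sum_add_distrib, ← Finset.mul_sum]
  have h0 := sum_int_le_two_tsum_nat G₀ hG₀0 hG₀s S'
  have h1 := sum_int_le_two_tsum_nat G₁ hG₁0 hG₁s S'
  have hT₁' : 2 * T₁ ≤ 2 * (T₁ / Real.log 2) * Real.log (|y| + 2) := by
    have : T₁ ≤ T₁ / Real.log 2 * Real.log (|y| + 2) := by
      rw [div_mul_eq_mul_div, le_div_iff₀ hlog2]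
      exact mul_le_mul_of_nonneg_left hLy hT₁0
    linarith
  calc Real.exp c * (Real.log (|y| + 2) * ∑ k ∈ S', G₀ k.natAbs + ∑ k ∈ S', G₁ k.natAbs)
      ≤ Real.exp c * (Real.log (|y| + 2) * (2 * T₀) + 2 * (T₁ / Real.log 2) * Real.log (|y| + 2)) := by
        refine mul_le_mul_of_nonneg_left ?_ (Real.exp_pos c).le
        exact add_le_add (mul_le_mul_of_nonneg_left h0 hLy0) (h1.trans hT₁')
    _ = Real.exp c * 2 * (T₀ + T₁ / Real.log 2) * Real.log (|y| + 2) := by ring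
    _ ≤ (Real.exp c * 2 * (T₀ + T₁ / Real.log 2) + 1) * Real.log (|y| + 2) := by nlinarith

end Summit.RiemannHypothesis.RiemannHypothesis.Theorems.DensityLadderSeparatedTowerSchur

end
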